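import Summits.BirchSwinnertonDyer.BirchSwinnertonDyer.Theorems.ByReductionTypeAtTwoAnalyticMuDepth
import Summits.BirchSwinnertonDyer.BirchSwinnertonDyer.Theorems.ByReductionTypeAtTwoAnalyticMuCollapse
import Literature.NumberTheory.EllipticCurves.PAdicLFunctionDistributionProofs
import Literature.NumberTheory.EllipticCurves.SupersingularDensitySerreFrobeniusProofs
import HarnessLib

/-!
# Route `ByReductionTypeAtTwo` (K4), crux `OrdMissingLowerBoundAtTwo` (stmt-BirchSwinnertonDyer-19577), line
# `kato-free-lower-sandwich-two` — S2 (RECURSION half): measure depth `s+1` ⟹ the winding classes at 2-power cusps are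
# `2^{s+1}`-FLAT of a slope of order dividing `4` (`--supports`, helper)

Cell `bsd-2adic`, lead `cruxlead-stmt-BirchSwinnertonDyer-19577` (g0).  THEOREMS ONLY — no definition, no named fact, no
`sorry`.  HONEST FRAMING: the crux 19577 and its research stub (`stub_periodDescentOfMeasureDepth`, skeleton v6) are NOT
closed here; BSD is not proved by any of this.

WHAT.  Card #8 (`odd-point-shimura-descent-two`) piece S2_s: «`μ ≥ s` ⟹ the dyadic profile of the winding functional is
`2^s`-FLAT».  Its analytic half (`μ(L₂) ≥ s+1` ⟹ all doubled Mazur–Swinnerton-Dyer values vanish mod `2^{s+1}`) is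
`…AnalyticMuDepth` (p656427).  This file is the RECURSION half, elementary 2-adic algebra on the tree's `ratPlusSymbol` /
`msdMeasure`:  for a rational normalised newform `f` of ODD level, `a₂ = ±1`, `α` the unit root of `X² − a₂X + 2`, IF
every doubled value `2μ_{f,α}(b + 2ᵐℤ₂)` (`m ≥ 1`, `b` odd) has norm `≤ B` THEN for all `k ≥ 0` and odd `b`

  `‖w_k(b) − k·w₁‖₂ ≤ B`,  `w_k(b) := 2([b/2ᵏ]⁺ − [0]⁺) ∈ ℤ`,  `w₁ := 2([1/2]⁺ − [0]⁺) = (a₂ − 3)·2[0]⁺`,  and  `‖4·w₁‖₂ ≤ B`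

(`norm_winding_sub_mul_le_of_measure_depth`, `norm_four_mul_winding_one_le_of_measure_depth`).  Mechanism (card #8 S2 docstring,
made kernel): the measure gives `α·W_{m+1}(b) ≡ W_m(b)` for `W_m := 2[b/2ᵐ]⁺` (`two_mul_msdMeasure_succ_intCast`), the Hecke
relation at `1/2` gives `W₁ = (a₂−2)·c`, `c := 2[0]⁺` (tree `two_mul_ratPlusSymbol_sub_one_eq`), whence `c(α−1)² ≡ 0`; then
`α(w_{m+1} − (m+1)w₁) = [αW_{m+1} − W_m] + [w_m − m·w₁] − m(α−1)w₁ − c(α−1)²` with `(α−1)w₁ = c(α−1)²(α−2)/α`, and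
`‖α − 1‖ ≥ ¼` (`quarter_le_norm_unitRoot_sub_one`: `v₂(α−1) ∈ {1,2}` as `a₂ = ±1`) bounds `4w₁`.  With `B = 2^{-(s+1)}`:
`exists_slope_winding_flat_of_measure_depth` — a slope `sl ∈ ℤ/2^{s+1}` with `4·sl = 0` and `w_k(b) ≡ k·sl` for all `k`, odd
`b` (the input shape `MultiFlatWith m (2^{s+1}) sl ∧ addOrderOf sl ∣ 4` of the crux-dir sketch's S3 `eisenstein_of_multiFlat`,
read on the 2-power cusps), and the curve-level form at an optimal good-ordinary curve from `¬ AnalyticMuLE W 2 s`, mod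
Abbes–Ullmo (`exists_slope_winding_flat_of_not_analyticMuLE_of_optimal`).  What remains of the research stub after this file:
S3 (flat ⟹ Eisenstein, proved in the crux-dir sketch modulo the span residual (α)) and (β) S4 `PeriodDescentOfEisensteinAtTwo`.

References: B. Mazur, J. Tate, J. Teitelbaum, Invent. Math. 84 (1986), §I.4 (4.2), §I.10 (10.1); B. Mazur,
P. Swinnerton-Dyer, Invent. Math. 25 (1974), §8.
-/

-- the summit namespace repeats `BirchSwinnertonDyer` by design (summit = problem); linter moot
set_option linter.dupNamespace false
set_option autoImplicit false

noncomputable section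

namespace Summit.BirchSwinnertonDyer.BirchSwinnertonDyer.Theorems.AnalyticMuTwo

open Filter Topology Finset
open scoped MatrixGroups ModularForm
open CongruenceSubgroup WeierstrassCurve Literature.NumberTheory.EllipticCurves
  Literature.NumberTheory.EllipticCurves.ModularForms Literature.NumberTheory.EllipticCurves.Rank1Residual

section Flat

variable {N : ℕ} [NeZero N] {f : CuspForm (Gamma0 N) 2}

/-- Periodicity of the rational plus symbol along a 2-power cusp: for an integer `b` and its class `a = b mod 2ᵐ`,
`[a.val/2ᵐ]⁺ = [b/2ᵐ]⁺`. [folklore] -/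
theorem ratPlusSymbol_val_div_eq (m : ℕ) (b : ℤ) :
    ratPlusSymbol f ((((b : ZMod (2 ^ m)).val : ℕ) : ℚ) / (2 : ℚ) ^ m) = ratPlusSymbol f ((b : ℚ) / (2 : ℚ) ^ m) := by
  haveI : NeZero (2 ^ m) := ⟨pow_ne_zero _ two_ne_zero⟩
  have hval : (((b : ZMod (2 ^ m)).val : ℕ) : ℤ) = b % (2 ^ m : ℕ) := ZMod.val_intCast b
  -- `b = (b mod 2ᵐ) + 2ᵐ·t`
  set t : ℤ := b / (2 ^ m : ℕ) with ht
  have hb : (b : ℚ) / (2 : ℚ) ^ m = ((((b : ZMod (2 ^ m)).val : ℕ) : ℚ) / (2 : ℚ) ^ m) + (t : ℤ) := by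
    have h := Int.emod_add_mul_ediv b (2 ^ m : ℕ)
    have h2 : ((2 : ℚ) ^ m) ≠ 0 := pow_ne_zero _ two_ne_zero
    have hbq : (b : ℚ) = (((b : ZMod (2 ^ m)).val : ℕ) : ℚ) + (2 : ℚ) ^ m * (t : ℚ) := by
      have : (b : ℤ) = (((b : ZMod (2 ^ m)).val : ℕ) : ℤ) + (2 ^ m : ℕ) * t := by rw [hval, ht]; exact h.symm
      have := congrArg (fun z : ℤ => (z : ℚ)) this
      push_cast at this
      exact this
    rw [hbq]
    field_simp
  rw [hb, ratPlusSymbol_add_intCast_eq]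

/-- The doubled MSD value at level `m+1` in terms of the doubled symbols `W_m(b) := 2[b/2ᵐ]⁺`:
`2μ_{f,α}(b + 2^{m+1}ℤ₂) = α⁻¹^{m+2}·(α·W_{m+1}(b) − W_m(b))`. [cite: MazurTateTeitelbaum1986Invent, §I.10 (10.1)] -/
theorem two_mul_msdMeasure_succ_intCast (α : ℚ_[2]) (hα0 : α ≠ 0) (m : ℕ) (b : ℤ) :
    2 * msdMeasure f α (m + 1) (b : ZMod (2 ^ (m + 1))) =
      α⁻¹ ^ (m + 2) * (α * ((2 * ratPlusSymbol f ((b : ℚ) / (2 : ℚ) ^ (m + 1)) : ℚ) : ℚ_[2]) -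
        ((2 * ratPlusSymbol f ((b : ℚ) / (2 : ℚ) ^ m) : ℚ) : ℚ_[2])) := by
  simp only [msdMeasure]
  have h2 : (((2 : ℕ) : ℚ)) = (2 : ℚ) := by norm_num
  rw [h2, ratPlusSymbol_val_div_eq (f := f) (m + 1) b]
  have hm : ratPlusSymbol f ((((b : ZMod (2 ^ (m + 1))).val : ℕ) : ℚ) / (2 : ℚ) ^ m) =
      ratPlusSymbol f ((b : ℚ) / (2 : ℚ) ^ m) := by
    -- `val ≡ b (mod 2^{m+1})` hence `(mod 2^m)`
    haveI : NeZero (2 ^ (m + 1)) := ⟨pow_ne_zero _ two_ne_zero⟩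
    have hval : (((b : ZMod (2 ^ (m + 1))).val : ℕ) : ℤ) = b % (2 ^ (m + 1) : ℕ) := ZMod.val_intCast b
    set t : ℤ := b / (2 ^ (m + 1) : ℕ) with ht
    have h := Int.emod_add_mul_ediv b (2 ^ (m + 1) : ℕ)
    have hbq : (((b : ZMod (2 ^ (m + 1))).val : ℕ) : ℚ) / (2 : ℚ) ^ m = (b : ℚ) / (2 : ℚ) ^ m + ((-(2 * t) : ℤ) : ℚ) := by
      have e : (((b : ZMod (2 ^ (m + 1))).val : ℕ) : ℤ) = b - (2 ^ (m + 1) : ℕ) * t := by rw [hval, ht]; omega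
      have e' := congrArg (fun z : ℤ => (z : ℚ)) e
      push_cast at e' ⊢
      rw [e']
      field_simp
      ring
    rw [hbq, ratPlusSymbol_add_intCast_eq]
  rw [hm]
  have hpow : α⁻¹ ^ (m + 1) = α⁻¹ ^ (m + 2) * α := by
    rw [pow_succ α⁻¹ (m + 1), mul_assoc, inv_mul_cancel₀ hα0, mul_one]
  rw [hpow]
  push_cast
  ring

/-- **S2, recursion half (`p = 2`): measure depth `s+1` ⟹ the winding classes at 2-power cusps are `2^{s+1}`-FLAT.**
`f` a rational normalised newform of ODD level, `a₂ = ±1`, `α` the unit root of `X² − a₂X + 2`.  If every doubled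
MSD value `2μ_{f,α}(b + 2ᵐℤ₂)`, `m ≥ 1`, `b` odd, has norm `≤ 2^{-(s+1)}`, then for all `k ≥ 0` and odd `b`
  `‖ w_k(b) − k·w₁ ‖₂ ≤ 2^{-(s+1)}`,   `w_k(b) := 2([b/2ᵏ]⁺ − [0]⁺) ∈ ℤ`, `w₁ := 2([1/2]⁺ − [0]⁺) = (a₂ − 3)·2[0]⁺`,
i.e. `w_k(b) ≡ k·w₁ (mod 2^{s+1})`: the dyadic profile of the winding functional is flat of slope `w₁`.  Proof: the
measure gives `α·W_{m+1} ≡ W_m`, the Hecke relation at `1/2` gives `W₁ = (a₂−2)·c` (`c = 2[0]⁺`), whence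
`c(α−1)² ≡ 0`; then `α(w_{m+1} − (m+1)w₁) = [αw_{m+1} − w_m + (α−1)c] + [w_m − m w₁] − m(α−1)w₁ − c(α−1)²` with
`(α−1)w₁ = c(α−1)²(α−2)/α`. [cite: MazurTateTeitelbaum1986Invent, §I.10 (10.1) and §I.4 (4.2)] -/
theorem norm_winding_sub_mul_le_of_measure_depth (hf : IsNewform0 f) (hQ : coeffField f = ⊥) (h2N : ¬ 2 ∣ N)
    {a₂ : ℤ} (ha₂ : cuspCoeff f 2 = a₂) {α : ℚ_[2]} (hαu : ‖α‖ = 1) (hroot : α ^ 2 - a₂ * α + 2 = 0)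
    {B : ℝ} (hB : 0 ≤ B)
    (hν : ∀ (m : ℕ) (b : ℤ), Odd b → ‖2 * msdMeasure f α (m + 1) (b : ZMod (2 ^ (m + 1)))‖ ≤ B)
    (k : ℕ) {b : ℤ} (hb : Odd b) :
    ‖(((2 : ℚ) * (ratPlusSymbol f ((b : ℚ) / (2 : ℚ) ^ k) - ratPlusSymbol f 0) -
        (k : ℚ) * (2 * (ratPlusSymbol f (1 / 2) - ratPlusSymbol f 0)) : ℚ) : ℚ_[2])‖ ≤ B := by
  haveI : Fact (Nat.Prime 2) := ⟨Nat.prime_two⟩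
  have hα0 : α ≠ 0 := by rintro rfl; norm_num at hroot
  have hαi : ‖α⁻¹‖ = 1 := by rw [norm_inv, hαu, inv_one]
  -- notation
  set S : ℚ → ℚ_[2] := fun r => ((ratPlusSymbol f r : ℚ) : ℚ_[2]) with hS
  set c : ℚ_[2] := 2 * S 0 with hc
  set W : ℕ → ℚ_[2] := fun m => 2 * S ((b : ℚ) / (2 : ℚ) ^ m) with hW
  set w₁ : ℚ_[2] := 2 * (S (1 / 2) - S 0) with hw₁
  -- (1) the measure congruence `‖α W_{m+1} − W_m‖ ≤ B`
  have hstep : ∀ m : ℕ, ‖α * W (m + 1) - W m‖ ≤ B := by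
    intro m
    have h := hν m b hb
    rw [two_mul_msdMeasure_succ_intCast α hα0 m b, norm_mul, norm_pow, hαi, one_pow, one_mul] at h
    have e : α * W (m + 1) - W m = α * ((2 * ratPlusSymbol f ((b : ℚ) / (2 : ℚ) ^ (m + 1)) : ℚ) : ℚ_[2]) -
        ((2 * ratPlusSymbol f ((b : ℚ) / (2 : ℚ) ^ m) : ℚ) : ℚ_[2]) := by
      simp only [hW, hS]; push_cast; ring
    rw [e]; exact h
  -- (2) Hecke at `1/2`: `w₁(b') = (a₂ − 3) c` for every odd `b'`; `W 0 = c`; `W 1 = w₁ + c`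
  have hHecke : ∀ b' : ℤ, Odd b' →
      2 * (S ((b' : ℚ) / (2 : ℚ) ^ 1) - S 0) = ((a₂ : ℚ) : ℚ_[2]) * c - 3 * c := by
    intro b' hb'
    have h := two_mul_ratPlusSymbol_sub_one_eq hf hQ h2N ha₂ hb'
    have h' := congrArg (fun q : ℚ => (q : ℚ_[2])) h
    simp only [hS, hc]
    push_cast at h' ⊢
    linear_combination h'
  have hw₁eq : w₁ = ((a₂ : ℚ) : ℚ_[2]) * c - 3 * c := by
    have h := hHecke 1 odd_one
    rw [hw₁, ← h]; norm_num
  have hW0 : W 0 = c := by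
    simp only [hW, hc, hS, pow_zero, div_one]
    rw [show (b : ℚ) = 0 + (b : ℤ) by ring, ratPlusSymbol_add_intCast_eq]
  have hW1 : W 1 = w₁ + c := by
    have h := hHecke b hb
    rw [hw₁eq]
    have : W 1 = 2 * (S ((b : ℚ) / (2 : ℚ) ^ 1) - S 0) + c := by simp only [hW, hc]; ring
    rw [this, h]
  -- (3) `‖c (α − 1)²‖ ≤ B`
  have hαa : α * ((a₂ : ℚ) : ℚ_[2]) = α ^ 2 + 2 := by
    have : ((a₂ : ℚ) : ℚ_[2]) = (a₂ : ℚ_[2]) := by push_cast; rfl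
    rw [this]; linear_combination -hroot
  have hK : ‖c * (α - 1) ^ 2‖ ≤ B := by
    have h := hstep 0
    rw [hW1, hW0, hw₁eq] at h
    have e : α * (((a₂ : ℚ) : ℚ_[2]) * c - 3 * c + c) - c = c * (α - 1) ^ 2 := by
      linear_combination c * hαa
    rwa [e] at h
  -- (4) `(α − 1) w₁ · α = c (α−1)² (α − 2)` and its norm
  have hw₁α : w₁ * α = c * (α - 1) * (α - 2) := by
    rw [hw₁eq]; linear_combination c * hαa
  have hsmall1 : ‖(α - 1) * w₁‖ ≤ B := by
    have e : (α - 1) * w₁ = c * (α - 1) ^ 2 * (α - 2) * α⁻¹ := by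
      field_simp
      linear_combination (α - 1) * hw₁α
    rw [e, norm_mul, norm_mul, hαi, mul_one]
    have h2 : ‖α - 2‖ ≤ 1 := by
      calc ‖α - 2‖ = ‖α + -2‖ := by ring_nf
        _ ≤ max ‖α‖ ‖(-2 : ℚ_[2])‖ := Padic.nonarchimedean _ _
        _ ≤ 1 := max_le hαu.le (by rw [norm_neg]; simpa using (Padic.norm_p (p := 2)).le.trans (by norm_num))
    calc ‖c * (α - 1) ^ 2‖ * ‖α - 2‖ ≤ B * 1 := mul_le_mul hK h2 (norm_nonneg _) hB
      _ = B := mul_one B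
  have hsmall2 : ‖α * w₁ + (α - 1) * c‖ ≤ B := by
    have e : α * w₁ + (α - 1) * c = c * (α - 1) ^ 2 := by rw [hw₁eq]; linear_combination c * hαa
    rw [e]; exact hK
  -- (5) induction
  have hmain : ∀ m : ℕ, ‖(W m - c) - (m : ℚ_[2]) * w₁‖ ≤ B := by
    intro m
    induction m with
    | zero => rw [hW0]; simp [hB]
    | succ m ih =>
      have h1 := hstep m
      -- `α·((W_{m+1} − c) − (m+1) w₁) = [αW_{m+1} − W_m] + [W_m − c − m w₁] − m (α−1) w₁ − (α w₁ + (α−1) c)`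
      have e : α * ((W (m + 1) - c) - ((m + 1 : ℕ) : ℚ_[2]) * w₁) =
          (α * W (m + 1) - W m) + ((W m - c) - (m : ℚ_[2]) * w₁) - (m : ℚ_[2]) * ((α - 1) * w₁) -
            (α * w₁ + (α - 1) * c) := by
        push_cast; ring
      have hC : ‖(m : ℚ_[2]) * ((α - 1) * w₁)‖ ≤ B := by
        rw [norm_mul]
        have hm1 : ‖(m : ℚ_[2])‖ ≤ 1 := by exact_mod_cast Padic.norm_int_le_one (m : ℤ)
        calc _ ≤ 1 * B := mul_le_mul hm1 hsmall1 (norm_nonneg _) zero_le_one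
          _ = B := one_mul B
      have hadd : ∀ x y : ℚ_[2], ‖x‖ ≤ B → ‖y‖ ≤ B → ‖x + y‖ ≤ B := fun x y hx hy =>
        (Padic.nonarchimedean _ _).trans (max_le hx hy)
      have hsub : ∀ x y : ℚ_[2], ‖x‖ ≤ B → ‖y‖ ≤ B → ‖x - y‖ ≤ B := fun x y hx hy => by
        rw [sub_eq_add_neg]; exact hadd _ _ hx (by rwa [norm_neg])
      have hn : ‖α * ((W (m + 1) - c) - ((m + 1 : ℕ) : ℚ_[2]) * w₁)‖ ≤ B := by
        rw [e]; exact hsub _ _ (hsub _ _ (hadd _ _ h1 ih) hC) hsmall2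
      rw [norm_mul, hαu, one_mul] at hn
      exact hn
  -- conclusion
  have e : (((2 : ℚ) * (ratPlusSymbol f ((b : ℚ) / (2 : ℚ) ^ k) - ratPlusSymbol f 0) -
        (k : ℚ) * (2 * (ratPlusSymbol f (1 / 2) - ratPlusSymbol f 0)) : ℚ) : ℚ_[2]) = (W k - c) - (k : ℚ_[2]) * w₁ := by
    simp only [hW, hc, hw₁, hS]; push_cast; ring
  rw [e]; exact hmain k

/-- **`‖α − 1‖₂ ≥ ¼` for the unit root at an ordinary `2` (`a₂ = ±1`)**: `(α−1)² = (a₂−2)α − 1` is `−(α−1) − 2`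
(`a₂ = 1`) resp. `−3(α−1) − 4` (`a₂ = −1`), of norm `½` resp. `¼` if `‖α−1‖ < ¼` — impossible for a square of norm
`< 1/16`.  So `v₂(α − 1) ∈ {1, 2}`. [folklore] -/
theorem quarter_le_norm_unitRoot_sub_one {a₂ : ℤ} (ha₂ : a₂ = 1 ∨ a₂ = -1) {α : ℚ_[2]}
    (hroot : α ^ 2 - a₂ * α + 2 = 0) : (1 / 4 : ℝ) ≤ ‖α - 1‖ := by
  haveI : Fact (Nat.Prime 2) := ⟨Nat.prime_two⟩
  by_contra hlt
  rw [not_le] at hlt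
  have h2 : ‖(2 : ℚ_[2])‖ = 2⁻¹ := by simpa using Padic.norm_p (p := 2)
  have h4 : ‖(4 : ℚ_[2])‖ = 4⁻¹ := by
    rw [show (4 : ℚ_[2]) = 2 ^ 2 by norm_num, norm_pow, h2]; norm_num
  have hsq : ‖(α - 1) ^ 2‖ < 1 / 16 := by
    rw [norm_pow]
    calc ‖α - 1‖ ^ 2 < (1 / 4) ^ 2 := by gcongr
      _ = 1 / 16 := by norm_num
  rcases ha₂ with rfl | rfl
  · -- `(α−1)² = −((α−1) + 2)`
    have e : (α - 1) ^ 2 = -((α - 1) + 2) := by push_cast at hroot; linear_combination hroot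
    have hne : ‖α - 1‖ ≠ ‖(2 : ℚ_[2])‖ := by rw [h2]; linarith
    have hn : ‖(α - 1) + 2‖ = 2⁻¹ := by
      rw [Padic.add_eq_max_of_ne hne, h2]; exact max_eq_right (by linarith)
    rw [e, norm_neg, hn] at hsq
    norm_num at hsq
  · -- `(α−1)² = −(3(α−1) + 4)`
    have e : (α - 1) ^ 2 = -(3 * (α - 1) + 4) := by push_cast at hroot; linear_combination hroot
    have h3 : ‖(3 : ℚ_[2]) * (α - 1)‖ = ‖α - 1‖ := by
      rw [norm_mul]
      have : ‖(3 : ℚ_[2])‖ = 1 := by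
        rw [show (3 : ℚ_[2]) = ((3 : ℤ) : ℚ_[2]) by norm_cast]
        exact le_antisymm (Padic.norm_int_le_one 3)
          (not_lt.mp fun h => by
            have := Padic.norm_intCast_lt_one_iff.mp h; omega)
      rw [this, one_mul]
    have hne : ‖(3 : ℚ_[2]) * (α - 1)‖ ≠ ‖(4 : ℚ_[2])‖ := by rw [h3, h4]; linarith
    have hn : ‖3 * (α - 1) + 4‖ = 4⁻¹ := by
      rw [Padic.add_eq_max_of_ne hne, h3, h4]; exact max_eq_right (by linarith)
    rw [e, norm_neg, hn] at hsq
    norm_num at hsq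

/-- **The slope has additive order dividing `4` mod `2^{s+1}`**: under the hypotheses of
`norm_winding_sub_mul_le_of_measure_depth` and `a₂ = ±1`, `‖4·w₁‖₂ ≤ B` (`4w₁·α(α−1) = 4c(α−1)²(α−2)`,
`‖c(α−1)²‖ ≤ B`, `‖α−1‖ ≥ ¼`). [cite: MazurTateTeitelbaum1986Invent, §I.10 (10.1)] -/
theorem norm_four_mul_winding_one_le_of_measure_depth (hf : IsNewform0 f) (hQ : coeffField f = ⊥) (h2N : ¬ 2 ∣ N)
    {a₂ : ℤ} (ha₂ : cuspCoeff f 2 = a₂) (ha₂' : a₂ = 1 ∨ a₂ = -1) {α : ℚ_[2]} (hαu : ‖α‖ = 1)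
    (hroot : α ^ 2 - a₂ * α + 2 = 0) {B : ℝ} (hB : 0 ≤ B)
    (hν : ∀ (m : ℕ) (b : ℤ), Odd b → ‖2 * msdMeasure f α (m + 1) (b : ZMod (2 ^ (m + 1)))‖ ≤ B) :
    ‖(((4 : ℚ) * (2 * (ratPlusSymbol f (1 / 2) - ratPlusSymbol f 0)) : ℚ) : ℚ_[2])‖ ≤ B := by
  haveI : Fact (Nat.Prime 2) := ⟨Nat.prime_two⟩
  have hα0 : α ≠ 0 := by rintro rfl; norm_num at hroot
  have hαi : ‖α⁻¹‖ = 1 := by rw [norm_inv, hαu, inv_one]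
  set S : ℚ → ℚ_[2] := fun r => ((ratPlusSymbol f r : ℚ) : ℚ_[2]) with hS
  set c : ℚ_[2] := 2 * S 0 with hc
  set w₁ : ℚ_[2] := 2 * (S (1 / 2) - S 0) with hw₁
  -- Hecke at `1/2`: `w₁ = (a₂ − 3) c`
  have hHecke : ∀ b' : ℤ, Odd b' →
      2 * (S ((b' : ℚ) / (2 : ℚ) ^ 1) - S 0) = ((a₂ : ℚ) : ℚ_[2]) * c - 3 * c := by
    intro b' hb'
    have h := two_mul_ratPlusSymbol_sub_one_eq hf hQ h2N ha₂ hb'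
    have h' := congrArg (fun q : ℚ => (q : ℚ_[2])) h
    simp only [hS, hc]
    push_cast at h' ⊢
    linear_combination h'
  have hw₁eq : w₁ = ((a₂ : ℚ) : ℚ_[2]) * c - 3 * c := by
    have h := hHecke 1 odd_one
    rw [hw₁, ← h]; norm_num
  have hαa : α * ((a₂ : ℚ) : ℚ_[2]) = α ^ 2 + 2 := by
    have : ((a₂ : ℚ) : ℚ_[2]) = (a₂ : ℚ_[2]) := by push_cast; rfl
    rw [this]; linear_combination -hroot
  -- the level-1 measure congruence at `b = 1`: `‖α W₁ − W₀‖ ≤ B`, `W₁ = w₁ + c`, `W₀ = c`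
  have hK : ‖c * (α - 1) ^ 2‖ ≤ B := by
    have h := hν 0 1 odd_one
    rw [two_mul_msdMeasure_succ_intCast α hα0 0 1, norm_mul, norm_pow, hαi, one_pow, one_mul] at h
    have e1 : ((2 * ratPlusSymbol f (((1 : ℤ) : ℚ) / (2 : ℚ) ^ (0 + 1)) : ℚ) : ℚ_[2]) = w₁ + c := by
      have : 2 * (S (((1 : ℤ) : ℚ) / (2 : ℚ) ^ 1) - S 0) = w₁ := by rw [hw₁]; norm_num
      simp only [hS, hc] at this ⊢
      push_cast at this ⊢
      linear_combination this
    have e0 : ((2 * ratPlusSymbol f (((1 : ℤ) : ℚ) / (2 : ℚ) ^ 0) : ℚ) : ℚ_[2]) = c := by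
      simp only [hc, hS]
      rw [pow_zero, div_one, show ((1 : ℤ) : ℚ) = 0 + (1 : ℤ) by push_cast; ring, ratPlusSymbol_add_intCast_eq]
      push_cast; ring
    rw [e1, e0, hw₁eq] at h
    have e : α * (((a₂ : ℚ) : ℚ_[2]) * c - 3 * c + c) - c = c * (α - 1) ^ 2 := by
      linear_combination c * hαa
    rwa [e] at h
  -- `4 w₁ α (α−1) = 4 c (α−1)² (α−2)`
  have hid : 4 * w₁ * (α * (α - 1)) = 4 * (c * (α - 1) ^ 2) * (α - 2) := by
    rw [hw₁eq]; linear_combination (4 * c * (α - 1)) * hαa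
  have h2 : ‖(2 : ℚ_[2])‖ = 2⁻¹ := by simpa using Padic.norm_p (p := 2)
  have h4 : ‖(4 : ℚ_[2])‖ = 4⁻¹ := by
    rw [show (4 : ℚ_[2]) = 2 ^ 2 by norm_num, norm_pow, h2]; norm_num
  have hα2 : ‖α - 2‖ ≤ 1 := by
    calc ‖α - 2‖ = ‖α + -2‖ := by ring_nf
      _ ≤ max ‖α‖ ‖(-2 : ℚ_[2])‖ := Padic.nonarchimedean _ _
      _ ≤ 1 := max_le hαu.le (by rw [norm_neg, h2]; norm_num)
  have hq := quarter_le_norm_unitRoot_sub_one ha₂' hroot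
  have hn : ‖4 * w₁‖ * ‖α - 1‖ ≤ 4⁻¹ * B := by
    have e1 : ‖4 * w₁‖ * ‖α - 1‖ = ‖4 * w₁ * (α * (α - 1))‖ := by
      rw [norm_mul (4 * w₁), norm_mul α, hαu, one_mul]
    rw [e1, hid, norm_mul, norm_mul, h4]
    calc 4⁻¹ * ‖c * (α - 1) ^ 2‖ * ‖α - 2‖ ≤ 4⁻¹ * B * 1 := by gcongr
      _ = 4⁻¹ * B := mul_one _
  have hle : ‖4 * w₁‖ ≤ B := by
    have h1 : ‖4 * w₁‖ * (1 / 4) ≤ ‖4 * w₁‖ * ‖α - 1‖ := mul_le_mul_of_nonneg_left hq (norm_nonneg _)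
    nlinarith [h1, hn, norm_nonneg (4 * w₁)]
  have e : (((4 : ℚ) * (2 * (ratPlusSymbol f (1 / 2) - ratPlusSymbol f 0)) : ℚ) : ℚ_[2]) = 4 * w₁ := by
    simp only [hw₁, hS]; push_cast; ring
  rw [e]; exact hle

end Flat

end Summit.BirchSwinnertonDyer.BirchSwinnertonDyer.Theorems.AnalyticMuTwo

end
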